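import Mathlib
import Summits.ValiantsHypothesis.ValiantsHypothesis.Theorems.BarrierLeverDefinableEquationsCoefficientFunctionCrux
import Literature.Computability.AlgebraicComplexity.BurgisserBooleanParts

/-!
# Crux `BarrierLever.DefinableEquations` (stmt-8745) / item `SingleSizeEquations` (stmt-8749) —
# the crux from `GapP`-CIRCUIT-EXPLICIT COEFFICIENT FUNCTIONS (Valiant's `#P ⊆ BP(VNP)` bridge at
# scale `N`, over the tree's Boolean straight-line programs; val-np-p5 g7)

`…CoefficientFunctionCrux.lean` made the crux equivalent to: equations of the degree-`n` forms of
circuit size `n^b` whose coefficient function is the Boolean-cube marginal of ONE poly(`N`)-size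
polynomial `Q₀` on bits.  This file supplies the standard source of such `Q₀` — COUNTING Boolean
circuits (Bürgisser 2000 TCS §5 (A2), "`#P ⊆ BP(VNP)`"; tree: `certCountPoly`,
`sum_eval_certCountPoly`) — so that a candidate equation can be specified by two well-formed
fan-in-`2` Boolean programs `γ₊, γ₋` (`List (Gate (Fin K ⊕ Fin m))` of the tree's
`Literature.Computability.Complexity`) reading the one-hot exponent bits through a decoding
`dec : Fin K → topMonomials n × Fin (D+1)` plus `m` certificate bits:

  `coeff_μ E = #{y ∈ {0,1}^m : γ₊(x_μ, y) = 1} - #{y ∈ {0,1}^m : γ₋(x_μ, y) = 1}`,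
  `x_μ(k) = [μ (dec k).1 = (dec k).2]`   (a `GapP`-style description of the coefficient function).

* `CountingCircuits.exists_coeffPoly` — the bits-only polynomial `Q₀ = rename (dec ⊕ id)
  (certCountPoly γ₊ - certCountPoly γ₋)` on `(topMonomials n × Fin (D+1)) ⊕ Fin (U+1)` has cube
  marginals `#acc(γ₊, x_μ) - #acc(γ₋, x_μ)`, `L(Q₀) ≤ 134 U + 13`, `deg Q₀ ≤ 8 U + 4`.
* `CountingCircuits.topEq_of_countingCircuits` — a nonzero `E ∈ ℂ[topMonomials n]` with such a
  coefficient function (`D, U ≤ N^c`), vanishing on the top components of `SmallCircuits ℂ n b`,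
  gives `TopEq(n, b, 2c + 11)` (`n ≥ 3`).
* `definableEquations_of_countingCircuits` — one scale `c` for every `b` ⇒ the crux.

Honest scope: a SUFFICIENT format (integer `GapP`-style coefficient functions); the crux stays open
(Chatterjee–Tengse 2023 §1.3 dir. 2) and nothing here bears on `VP ≠ VNP`.  No definitions, no
named facts.  Refs: P. Bürgisser, *Cook's versus Valiant's hypothesis*, TCS 235 (2000) §5 (A2);
L. G. Valiant, STOC 1979; P. Bürgisser, *Completeness and Reduction* (2000), Prop. 2.20.
-/

set_option linter.dupNamespace false

noncomputable section

namespace Summit.ValiantsHypothesis.ValiantsHypothesis.Theorems.BarrierLeverDefinableEquations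

open MvPolynomial Literature.Computability.AlgebraicComplexity
open Literature.Barriers.ValiantsHypothesis
open Literature.Computability.Complexity Literature.Computability.Complexity.GateList
open scoped BigOperators

namespace CountingCircuits

variable {n D K m U P : ℕ}

/-- **The bits-only polynomial of a pair of counting circuits.**  For well-formed fan-in-`2`
programs `γ₊, γ₋` on `K` input and `m` certificate bits (`m ≤ P`, `P + |γ| ≤ U`) and a decoding
`dec : Fin K → topMonomials n × Fin (D+1)` of the input positions, the polynomial
`Q₀ = rename (dec ⊕ id) (certCountPoly γ₊ - certCountPoly γ₋)` has Boolean-cube marginal at the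
one-hot point of every exponent function `μ` equal to `#acc(γ₊, x_μ) - #acc(γ₋, x_μ)`,
`x_μ = oneHot μ ∘ dec`; `L(Q₀) ≤ 134 U + 13`, `deg Q₀ ≤ 8 U + 4`.
[cite: Burgisser2000TCS, §5 (A2) pp. 84–85] -/
theorem exists_coeffPoly (dec : Fin K → ↥(topMonomials n) × Fin (D + 1))
    (gs₁ gs₂ : List (Gate (Fin K ⊕ Fin m))) (out₁ out₂ : (Fin K ⊕ Fin m) ⊕ ℕ)
    (hwf₁ : WF gs₁) (hwf₂ : WF gs₂) (hB₁ : ∀ g ∈ gs₁, g.arity ≤ 2) (hB₂ : ∀ g ∈ gs₂, g.arity ≤ 2)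
    (hout₁ : ∀ j, out₁ = .inr j → j < gs₁.length) (hout₂ : ∀ j, out₂ = .inr j → j < gs₂.length)
    (hm : m ≤ P) (hs₁ : P + gs₁.length ≤ U) (hs₂ : P + gs₂.length ≤ U) :
    ∃ Q₀ : MvPolynomial ((↥(topMonomials n) × Fin (D + 1)) ⊕ Fin (U + 1)) ℂ,
      complexity Q₀ ≤ 134 * U + 13 ∧ Q₀.totalDegree ≤ 8 * U + 4 ∧
      ∀ μ : ↥(topMonomials n) →₀ ℕ,
        (∑ w : Fin (U + 1) → Bool, eval (fun x => if Sum.elim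
            (fun p : ↥(topMonomials n) × Fin (D + 1) => decide (μ p.1 = (p.2 : ℕ))) w x
            then (1 : ℂ) else 0) Q₀) =
          (((Finset.univ.filter fun y : Fin m → Bool =>
              wireOf (Sum.elim (fun k => decide (μ (dec k).1 = ((dec k).2 : ℕ))) y)
                (vals gs₁ (Sum.elim (fun k => decide (μ (dec k).1 = ((dec k).2 : ℕ))) y)) out₁ =
                true).card : ℕ) : ℂ) -
          (((Finset.univ.filter fun y : Fin m → Bool =>
              wireOf (Sum.elim (fun k => decide (μ (dec k).1 = ((dec k).2 : ℕ))) y)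
                (vals gs₂ (Sum.elim (fun k => decide (μ (dec k).1 = ((dec k).2 : ℕ))) y)) out₂ =
                true).card : ℕ) : ℂ) := by
  classical
  refine ⟨rename (Sum.map dec id)
      (certCountPoly (k := ℂ) K m U P gs₁ out₁ - certCountPoly (k := ℂ) K m U P gs₂ out₂),
    ?_, ?_, fun μ => ?_⟩
  · refine (complexity_rename_le_holds' _ _).trans ?_
    have h1 := complexity_certCountPoly_le (k := ℂ) (n := K) (m := m) hB₁ hs₁ out₁
    have h2 := complexity_certCountPoly_le (k := ℂ) (n := K) (m := m) hB₂ hs₂ out₂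
    have h3 : complexity (certCountPoly (k := ℂ) K m U P gs₁ out₁ -
        certCountPoly (k := ℂ) K m U P gs₂ out₂) ≤
        complexity (certCountPoly (k := ℂ) K m U P gs₁ out₁) +
          complexity (certCountPoly (k := ℂ) K m U P gs₂ out₂) + 2 := by
      rw [sub_eq_add_neg]
      refine (complexity_add_le_holds _ _).trans ?_
      have h4 : complexity (-certCountPoly (k := ℂ) K m U P gs₂ out₂) ≤
          complexity (certCountPoly (k := ℂ) K m U P gs₂ out₂) + 1 := by
        rw [show -certCountPoly (k := ℂ) K m U P gs₂ out₂ =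
            C (-1) * certCountPoly (k := ℂ) K m U P gs₂ out₂ by rw [map_neg, map_one]; ring]
        have h5 := complexity_mul_le_holds (C (-1) : MvPolynomial (Fin K ⊕ Fin (U + 1)) ℂ)
          (certCountPoly (k := ℂ) K m U P gs₂ out₂)
        have h6 := complexity_C_holds (σ := Fin K ⊕ Fin (U + 1)) (-1 : ℂ)
        omega
      omega
    omega
  · refine (totalDegree_rename_le _ _).trans ((totalDegree_sub _ _).trans (max_le ?_ ?_))
    · exact (totalDegree_certCountPoly_le (k := ℂ) hB₁ hs₁ out₁).trans (by omega)
    · exact (totalDegree_certCountPoly_le (k := ℂ) hB₂ hs₂ out₂).trans (by omega)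
  · set xμ : Fin K → Bool := fun k => decide (μ (dec k).1 = ((dec k).2 : ℕ)) with hxμ
    have hpt : ∀ w : Fin (U + 1) → Bool, ((fun x => if Sum.elim
        (fun p : ↥(topMonomials n) × Fin (D + 1) => decide (μ p.1 = (p.2 : ℕ))) w x
        then (1 : ℂ) else 0) ∘ Sum.map dec id) = boolPoint ℂ (Sum.elim xμ w) := by
      intro w
      funext x
      rcases x with k | j
      · simp [boolPoint, xμ]
      · simp [boolPoint]
    simp_rw [eval_rename, hpt, map_sub]
    rw [Finset.sum_sub_distrib, sum_eval_certCountPoly hwf₁ hout₁ hm hs₁ xμ,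
      sum_eval_certCountPoly hwf₂ hout₂ hm hs₂ xμ]

/-- Level arithmetic: `134 U + 13, 8 U + 4, U + 1, D ≤ N^(c+2)` for `D, U ≤ N^c`, `N ≥ 13`.
[folklore] -/
theorem arith {N c D U : ℕ} (hN : 13 ≤ N) (hD : D ≤ N ^ c) (hU : U ≤ N ^ c) :
    D ≤ N ^ (c + 2) ∧ U + 1 ≤ N ^ (c + 2) ∧ 134 * U + 13 ≤ N ^ (c + 2) ∧
      8 * U + 4 ≤ N ^ (c + 2) := by
  have hN0 : 0 < N := by omega
  have h1 : 1 ≤ N ^ c := Nat.one_le_pow _ _ hN0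
  have hsq : 147 ≤ N ^ 2 := by nlinarith
  have hbig : 147 * N ^ c ≤ N ^ (c + 2) := by
    calc 147 * N ^ c ≤ N ^ 2 * N ^ c := Nat.mul_le_mul_right _ hsq
      _ = N ^ (c + 2) := by ring
  refine ⟨?_, ?_, ?_, ?_⟩ <;> omega

/-- **Counting-circuit coefficient function ⇒ top witness** (`n ≥ 3`; scale `c` ⇒ level
`2c + 11`): a nonzero `E ∈ ℂ[topMonomials n]` vanishing on the top components of
`SmallCircuits ℂ n b`, with exponents `≤ D` and coefficients `#acc(γ₊, x_μ) - #acc(γ₋, x_μ)` for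
counting programs of size `U` (`D, U ≤ N^c`), yields `TopEq(n, b, 2c + 11)`.
[cite: Burgisser2000TCS, §5 (A2) pp. 84–85] -/
theorem topEq_of_countingCircuits {c b n : ℕ} (hn : 3 ≤ n)
    (h : ∃ D K m U P : ℕ, D ≤ (Nat.choose (2 * n) n) ^ c ∧ U ≤ (Nat.choose (2 * n) n) ^ c ∧
      ∃ (dec : Fin K → ↥(topMonomials n) × Fin (D + 1))
        (gs₁ gs₂ : List (Gate (Fin K ⊕ Fin m))) (out₁ out₂ : (Fin K ⊕ Fin m) ⊕ ℕ),
        WF gs₁ ∧ WF gs₂ ∧ (∀ g ∈ gs₁, g.arity ≤ 2) ∧ (∀ g ∈ gs₂, g.arity ≤ 2) ∧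
        (∀ j, out₁ = .inr j → j < gs₁.length) ∧ (∀ j, out₂ = .inr j → j < gs₂.length) ∧
        m ≤ P ∧ P + gs₁.length ≤ U ∧ P + gs₂.length ≤ U ∧
        ∃ E : MvPolynomial ↥(topMonomials n) ℂ, E ≠ 0 ∧
          (∀ f ∈ SmallCircuits ℂ n b,
            eval (fun e : topMonomials n => coeff (e : Fin n →₀ ℕ) f) E = 0) ∧
          (∀ μ ∈ E.support, ∀ e, μ e ≤ D) ∧
          ∀ μ : ↥(topMonomials n) →₀ ℕ, (∀ e, μ e ≤ D) → coeff μ E =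
            (((Finset.univ.filter fun y : Fin m → Bool =>
                wireOf (Sum.elim (fun k => decide (μ (dec k).1 = ((dec k).2 : ℕ))) y)
                  (vals gs₁ (Sum.elim (fun k => decide (μ (dec k).1 = ((dec k).2 : ℕ))) y)) out₁ =
                  true).card : ℕ) : ℂ) -
            (((Finset.univ.filter fun y : Fin m → Bool =>
                wireOf (Sum.elim (fun k => decide (μ (dec k).1 = ((dec k).2 : ℕ))) y)
                  (vals gs₂ (Sum.elim (fun k => decide (μ (dec k).1 = ((dec k).2 : ℕ))) y)) out₂ =
                  true).card : ℕ) : ℂ)) :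
    ∃ q : ℕ, q ≤ (Nat.choose (2 * n) n) ^ (2 * (c + 2) + 7) ∧
      ∃ H : MvPolynomial (↥(topMonomials n) ⊕ Fin q) ℂ,
        complexity H ≤ (Nat.choose (2 * n) n) ^ (2 * (c + 2) + 7) ∧
        H.totalDegree ≤ (Nat.choose (2 * n) n) ^ (2 * (c + 2) + 7) ∧
        boolSum H ≠ 0 ∧
        ∀ f ∈ SmallCircuits ℂ n b,
          eval (fun e : topMonomials n => coeff (e : Fin n →₀ ℕ) f) (boolSum H) = 0 := by
  obtain ⟨D, K, m, U, P, hD, hU, dec, gs₁, gs₂, out₁, out₂, hwf₁, hwf₂, hB₁, hB₂, hout₁, hout₂,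
    hm, hs₁, hs₂, E, hE0, hvan, hsupp, hcoeff⟩ := h
  obtain ⟨Q₀, hQc, hQd, hmarg⟩ :=
    exists_coeffPoly dec gs₁ gs₂ out₁ out₂ hwf₁ hwf₂ hB₁ hB₂ hout₁ hout₂ hm hs₁ hs₂
  -- `N ≥ C(6,3) = 20 ≥ 13`
  have hN : 13 ≤ Nat.choose (2 * n) n := by
    have h6 : Nat.choose (2 * 3) 3 ≤ Nat.choose (2 * n) n := by
      calc Nat.choose (2 * 3) 3 ≤ Nat.choose (2 * 3 + (2 * n - 2 * 3)) 3 :=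
            Nat.choose_mono _ (by omega)
        _ = Nat.choose (2 * n) 3 := by rw [Nat.add_sub_cancel' (by omega)]
        _ ≤ Nat.choose (2 * n) n := Nat.choose_le_middle 3 (2 * n) |>.trans (by
            rw [Nat.mul_div_cancel_left n Nat.two_pos])
    have : Nat.choose (2 * 3) 3 = 20 := by decide
    omega
  obtain ⟨hD', hr', hL', hd'⟩ := arith (c := c) hN hD hU
  exact CoefficientCrux.topEq_of_explicit (by omega)
    ⟨D, U + 1, hD', hr', Q₀, hQc.trans hL', hQd.trans hd', E, hE0, hvan, hsupp,
      fun μ hμ => by rw [hcoeff μ hμ, hmarg μ]⟩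

end CountingCircuits

open CountingCircuits

/-- **The crux from `GapP`-circuit-explicit coefficient functions.**  If for some `c`, for every
`b`, eventually in `n`, there are counting programs `γ₊, γ₋` of size `≤ N^c` (fan-in `2`, reading
one-hot exponent bits of degree `≤ D ≤ N^c` and certificate bits) and a NONZERO
`E ∈ ℂ[topMonomials n]` vanishing on the top components of `SmallCircuits ℂ n b` with
`coeff_μ E = #acc(γ₊, x_μ) - #acc(γ₋, x_μ)`, then `DefinableEquations` (level `2c + 11`).
[cite: Burgisser2000TCS, §5 (A2) pp. 84–85] -/
theorem definableEquations_of_countingCircuits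
    (h : ∃ c : ℕ, ∀ b : ℕ, ∃ n₀ : ℕ, ∀ n ≥ n₀,
      ∃ D K m U P : ℕ, D ≤ (Nat.choose (2 * n) n) ^ c ∧ U ≤ (Nat.choose (2 * n) n) ^ c ∧
      ∃ (dec : Fin K → ↥(topMonomials n) × Fin (D + 1))
        (gs₁ gs₂ : List (Gate (Fin K ⊕ Fin m))) (out₁ out₂ : (Fin K ⊕ Fin m) ⊕ ℕ),
        WF gs₁ ∧ WF gs₂ ∧ (∀ g ∈ gs₁, g.arity ≤ 2) ∧ (∀ g ∈ gs₂, g.arity ≤ 2) ∧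
        (∀ j, out₁ = .inr j → j < gs₁.length) ∧ (∀ j, out₂ = .inr j → j < gs₂.length) ∧
        m ≤ P ∧ P + gs₁.length ≤ U ∧ P + gs₂.length ≤ U ∧
        ∃ E : MvPolynomial ↥(topMonomials n) ℂ, E ≠ 0 ∧
          (∀ f ∈ SmallCircuits ℂ n b,
            eval (fun e : topMonomials n => coeff (e : Fin n →₀ ℕ) f) E = 0) ∧
          (∀ μ ∈ E.support, ∀ e, μ e ≤ D) ∧
          ∀ μ : ↥(topMonomials n) →₀ ℕ, (∀ e, μ e ≤ D) → coeff μ E =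
            (((Finset.univ.filter fun y : Fin m → Bool =>
                wireOf (Sum.elim (fun k => decide (μ (dec k).1 = ((dec k).2 : ℕ))) y)
                  (vals gs₁ (Sum.elim (fun k => decide (μ (dec k).1 = ((dec k).2 : ℕ))) y)) out₁ =
                  true).card : ℕ) : ℂ) -
            (((Finset.univ.filter fun y : Fin m → Bool =>
                wireOf (Sum.elim (fun k => decide (μ (dec k).1 = ((dec k).2 : ℕ))) y)
                  (vals gs₂ (Sum.elim (fun k => decide (μ (dec k).1 = ((dec k).2 : ℕ))) y)) out₂ =
                  true).card : ℕ) : ℂ)) :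
    Summit.ValiantsHypothesis.ValiantsHypothesis.Theses.BarrierLever.DefinableEquations := by
  rw [definableEquations_iff_topEquations]
  obtain ⟨c, hc⟩ := h
  refine ⟨2 * (c + 2) + 7, fun b => ?_⟩
  obtain ⟨n₀, hn₀⟩ := hc b
  refine ⟨max n₀ 3, fun n hn => ?_⟩
  exact topEq_of_countingCircuits (le_trans (le_max_right _ _) hn)
    (hn₀ n (le_trans (le_max_left _ _) hn))

end Summit.ValiantsHypothesis.ValiantsHypothesis.Theorems.BarrierLeverDefinableEquations

end
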